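import Summits.AnomalousDissipation.AnomalousDissipation.Theorems.FloorCertificate.Negative.InjectedBeat

/-!
# `TaylorCertificates.FloorCertificate` (stmt-AnomalousDissipation-14091) — negative side III:
# no floor certificate of BOUNDED RESOLUTION exists, for any force, whatever the weight

cdisprove seat `refuter-cdisprove-stmt-AnomalousDissipation-14091-g2-0` (cycle 2), 2026-08-16.

The natural strengthening `FloorCertificateFixedResolution` of the crux — the test fields of the
cylindrical multiplier `Φ₁ = φ((·,g₁),…,(·,gₘ))` are trigonometric polynomials of a `ν`-INDEPENDENT degree
`N`, while the profile `φ = φ_ν`, the number of fields and the weight `θ₁ = θ₁(ν) ≤ 0` are free to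
degenerate with `ν` — is FALSE for EVERY force (`not_floorCertificateFixedResolution`). The quantitative
form `floor_fails_at_fixed_resolution` says more: for every smooth solenoidal mean-zero `f`, every
`ε₀ > 0` and every `N` there is `ν₁ = ν₁(f, ε₀, N) > 0` such that for EVERY `ν ≤ ν₁`, EVERY band-limited
`Φ₁` of degree `≤ N` and EVERY `θ₁ ≤ 0` some finite-enstrophy state of the Leray ball violates the floor.
So the resolution `N(ν)` of any witness of `FloorCertificate` must tend to infinity as `ν → 0`; the
unbounded weight cannot substitute for resolution (compare `not_floorCertificateUniform`, where both
`Φ₁` and `θ₁` were frozen).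

Witness (injected beat). Let `ĉ = f̂(k₀) ≠ 0` be a Fourier mode of the force and
`u₀ = Re(e_{k₀} σĉ)` the corresponding single mode with a LARGE amplitude `σ` (energy input
`(u₀, f) = σ‖ĉ‖²`). Given `ν`, `Φ₁` (band-limited by `N`) and `θ₁ ≤ 0`, put `W := Φ₁'(u₀)` and
`𝔊² := ∑_{|κ|≤N} ‖Ŵ(κ)‖²`. If `𝔊 = 0` the floor at `u₀` already reads `ε₀ ≤ ν‖∇u₀‖²` (the single
transversal mode has no self-interaction and injects energy, so the weight term is `≤ 0`). Otherwise let
`q` maximise `‖Ŵ(κ)‖` over the ball, take the integer frame `r ⊥ q`, the real unit `B ⊥ r, q` with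
`2|ζ|² ≥ ‖Ŵ(q)‖²` (`ζ = ⟪Ŵ(q), B⟫`, `frame_selection`) and two waves `Re(e_p zA) + Re(e_{p+q} zB)` at
`p = t r` far outside the ball (`wave_frequencies_gen`), `zA = (α/|q|) q`, `zB = ω α B`, with a FIXED
amplitude `α`, `πα² = (‖f‖₂ + 2)√(2 #ball)`. The waves are invisible to the test fields, so
`Φ₁'(u₀ + waves) = W`; every interaction except the `(p, p+q)` beat at `q` falls outside the band or on
a transversal coefficient (`inertial_beat_gen`), and the beat is worth `−πα²|q||ζ| ≤ −(‖f‖₂ + 2)𝔊`,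
while `(f, W) ≤ ‖f‖₂ 𝔊` and `ν(u, ΔW) ≤ 𝔊` (for `ν` small). The energy input
`(u, f) ≥ σ‖ĉ‖² − 2α‖f‖₂ = 2` exceeds the dissipation `ν‖∇u‖² ≤ 1`, so `2θ₁((u,f) − ν‖∇u‖²) ≤ 0` for EVERY
`θ₁ ≤ 0`: the floor at the beat state reads `ε₀ ≤ ν‖∇u‖² − 𝔊 ≤ ε₀/2`. All smallness conditions on `ν`
are upper bounds depending on `(f, ε₀, N)` only.
-/

noncomputable section

set_option linter.dupNamespace false

open MeasureTheory UnitAddTorus Matrix Filter Topology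
open scoped InnerProductSpace ENNReal ComplexConjugate

namespace Summit.AnomalousDissipation.AnomalousDissipation.Theorems.FloorCertificate.Negative

open Literature.Analysis.FunctionSpaces Literature.Analysis.FluidPDE
open Summit.AnomalousDissipation.AnomalousDissipation.Theses.TaylorCertificates
open Summit.AnomalousDissipation.AnomalousDissipation.Theorems.TaylorCertificatePair.Negative

/-! ### §F.8 The strengthening of bounded resolution and its refutation -/

/-- NATURAL STRENGTHENING of the crux — floor certificates of BOUNDED RESOLUTION: some force, `ε₀, ν₀`
and a `ν`-INDEPENDENT degree `N` such that for every `ν ∈ (0, ν₀)` some cylindrical multiplier whose test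
fields are trigonometric polynomials of degree `≤ N` (profile `φ`, number of fields and weight `θ₁ ≤ 0`
free to depend on `ν`) certifies the floor. It implies `FloorCertificate` (forget the band limitation;
one line, kept out of this negative-side file) and is FALSE for every force
(`not_floorCertificateFixedResolution`). -/
def FloorCertificateFixedResolution : Prop :=
  ∃ f : (UnitAddTorus (Fin 3) → EuclideanSpace ℝ (Fin 3)), Torus.IsSmooth f ∧ Torus.IsDivFree f ∧ Torus.HasZeroMean f ∧
    ∃ (ε₀ ν₀ : ℝ) (N : ℕ), 0 < ε₀ ∧ 0 < ν₀ ∧ ∀ ν : ℝ, 0 < ν → ν < ν₀ →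
      ∃ (Φ₁ : Torus.CylindricalTest (Fin 3)) (θ₁ : ℝ), (∀ i, Torus.fourierTruncate N (Φ₁.g i) = Φ₁.g i) ∧ θ₁ ≤ 0 ∧
        ∀ u : (Torus.energySpace (Fin 3)), FloorIneq ν f Φ₁ θ₁ ε₀ u

set_option maxHeartbeats 1600000 in
/-- **The floor fails at every fixed resolution, for every force** (quantitative core). For every smooth
solenoidal mean-zero `f`, every `ε₀ > 0` and every degree `N` there is `ν₁ > 0` such that for EVERY
`0 < ν ≤ ν₁`, EVERY cylindrical `Φ` with test fields of degree `≤ N` and EVERY weight `θ ≤ 0`, some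
finite-enstrophy state of the Leray ball violates the FLOOR inequality (witness: the injected beat, see the
module docstring). -/
theorem floor_fails_at_fixed_resolution {f : (UnitAddTorus (Fin 3) → EuclideanSpace ℝ (Fin 3))} (hfs : Torus.IsSmooth f)
    (hdiv : Torus.IsDivFree f) (hmean : Torus.HasZeroMean f) {ε₀ : ℝ} (hε₀ : 0 < ε₀) (N : ℕ) :
    ∃ ν₁ : ℝ, 0 < ν₁ ∧ ∀ ν : ℝ, 0 < ν → ν ≤ ν₁ →
      ∀ (Φ : Torus.CylindricalTest (Fin 3)) (θ : ℝ), (∀ i, Torus.fourierTruncate N (Φ.g i) = Φ.g i) → θ ≤ 0 →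
        ∃ u : (Torus.energySpace (Fin 3)), ¬ FloorIneq ν f Φ θ ε₀ u := by
  have hF2nn : 0 ≤ ∫ x, ‖f x‖ ^ 2 := integral_nonneg fun x => by positivity
  by_cases hF0 : ∫ x, ‖f x‖ ^ 2 = 0
  · /- a vanishing force: the rest state violates every floor -/
    refine ⟨1, one_pos, fun ν hν _ Φ θ _ _ => ⟨0, fun hfl => ?_⟩⟩
    have h1 : Torus.eGradNormSq (((0 : (Torus.energySpace (Fin 3))) : (Lp (EuclideanSpace ℝ (Fin 3)) 2 (volume : Measure (UnitAddTorus (Fin 3))))) : (UnitAddTorus (Fin 3)) → (EuclideanSpace ℝ (Fin 3))) ≠ ⊤ := by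
      rw [eGradNormSq_coe_zero]; exact ENNReal.zero_ne_top
    have h2 : ‖(0 : (Torus.energySpace (Fin 3)))‖ ^ 2 ≤ 16 * (∫ x, ‖f x‖ ^ 2) / ν ^ 2 := by
      rw [norm_zero, hF0]; norm_num
    have h := hfl h1 h2
    have hzero := certificate_terms_at_zero (ae_zero_of_integral_sq_zero hfs hF0) ν θ (Φ.grad 0)
    linarith
  /- Step 1: the constants `F, k₀, ĉ, c, K, card, Λ, α, σ, S, L, E` and the threshold `ν₁`. -/
  have hF2pos : 0 < ∫ x, ‖f x‖ ^ 2 := lt_of_le_of_ne hF2nn (Ne.symm hF0)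
  obtain ⟨F, hFdef⟩ : ∃ F : ℝ, F = Real.sqrt (∫ x, ‖f x‖ ^ 2) := ⟨_, rfl⟩
  have hF : 0 < F := by rw [hFdef]; exact Real.sqrt_pos.2 hF2pos
  have hFsq : F ^ 2 = ∫ x, ‖f x‖ ^ 2 := by rw [hFdef]; exact Real.sq_sqrt hF2nn
  obtain ⟨k₀, hk₀, hck⟩ := exists_fc_ne_zero_of_force hfs hmean hF2pos
  obtain ⟨ĉ, hĉdef⟩ : ∃ ĉ : (EuclideanSpace ℂ (Fin 3)), ĉ = mFourierCoeff (EuclideanSpace.complexify ∘ f) k₀ := ⟨_, rfl⟩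
  rw [← hĉdef] at hck
  obtain ⟨c, hcdef⟩ : ∃ c : ℝ, c = ‖ĉ‖ := ⟨_, rfl⟩
  have hc : 0 < c := by rw [hcdef]; exact norm_pos_iff.2 hck
  obtain ⟨K, hKdef⟩ : ∃ K : ℕ, K = ⌈Torus.freqNormSq k₀⌉₊ := ⟨_, rfl⟩
  have hk₀K : Torus.freqNormSq k₀ ≤ (K : ℝ) := by rw [hKdef]; exact Nat.le_ceil _
  have hfk1 : 1 ≤ Torus.freqNormSq k₀ := Torus.one_le_freqNormSq_of_ne_zero hk₀
  have hK1' : (1 : ℝ) ≤ K := hfk1.trans hk₀K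
  have hK1 : 1 ≤ K := by exact_mod_cast hK1'
  obtain ⟨card, hcarddef⟩ : ∃ card : ℝ, card = ((Torus.freqBall (d := Fin 3) N).card : ℝ) := ⟨_, rfl⟩
  have hcard1 : 1 ≤ card := by
    have : 1 ≤ (Torus.freqBall (d := Fin 3) N).card :=
      Finset.card_pos.2 ⟨0, Torus.zero_mem_freqBall N⟩
    rw [hcarddef]; exact_mod_cast this
  obtain ⟨Λ, hΛdef⟩ : ∃ Λ : ℝ, Λ = Real.sqrt (2 * card) := ⟨_, rfl⟩
  have hΛ : 0 < Λ := by rw [hΛdef]; exact Real.sqrt_pos.2 (by linarith)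
  have hΛsq : Λ ^ 2 = 2 * card := by rw [hΛdef]; exact Real.sq_sqrt (by linarith)
  obtain ⟨α, hαdef⟩ : ∃ α : ℝ, α = Real.sqrt ((F + 2) * Λ / Real.pi) := ⟨_, rfl⟩
  have hα : 0 < α := by rw [hαdef]; exact Real.sqrt_pos.2 (by positivity)
  have hαsq : Real.pi * α ^ 2 = (F + 2) * Λ := by
    rw [hαdef, Real.sq_sqrt (by positivity)]
    field_simp
  obtain ⟨σ, hσdef⟩ : ∃ σ : ℝ, σ = (2 * α * F + 2) / c ^ 2 := ⟨_, rfl⟩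
  have hσ : 0 < σ := by rw [hσdef]; positivity
  have hσc : σ * c ^ 2 = 2 * α * F + 2 := by rw [hσdef]; field_simp
  obtain ⟨S, hSdef⟩ : ∃ S : ℝ, S = σ * c + 2 * α := ⟨_, rfl⟩
  have hS : 0 < S := by rw [hSdef]; positivity
  have hσcS : σ * c ≤ S := by rw [hSdef]; linarith
  obtain ⟨L, hLdef⟩ : ∃ L : ℕ, L = N ^ 2 + 2 * N + 2 * K + 5 := ⟨_, rfl⟩
  have hLK : (K : ℝ) ≤ (L : ℝ) ^ 2 := by
    have hN0 : (0 : ℝ) ≤ N := Nat.cast_nonneg N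
    have h1 : (K : ℝ) ≤ L := by rw [hLdef]; push_cast; nlinarith
    have h2 : (1 : ℝ) ≤ L := hK1'.trans h1
    nlinarith
  have hk₀L : Torus.freqNormSq k₀ ≤ (L : ℝ) ^ 2 := hk₀K.trans hLK
  obtain ⟨E, hEdef⟩ : ∃ E : ℝ, E = 4 * Real.pi ^ 2 * (L : ℝ) ^ 2 * S ^ 2 := ⟨_, rfl⟩
  have hE : 0 ≤ E := by rw [hEdef]; positivity
  obtain ⟨ν₁, hν₁, hdem⟩ := exists_threshold (a₁ := E) (a₂ := E) (a₃ := σ * c * (4 * Real.pi ^ 2 * K)) (a₄ := S)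
    (b₁ := ε₀ / 2) (b₂ := 1) (b₃ := 1) (b₄ := 4 * F) hE hE (by positivity) hS.le (by positivity) one_pos one_pos (by positivity)
  refine ⟨ν₁, hν₁, fun ν hν hνle Φ θ hΦ hθ => ?_⟩
  obtain ⟨hd1, hd2, hd3, hd4⟩ := hdem ν hν hνle
  /- Step 2: the injected polarisation `σ ĉ` and the single-mode state `ue`. -/
  have hdz : ((fun j => ((k₀) j : ℂ)) ⬝ᵥ (WithLp.ofLp (((σ : ℂ) • ĉ)))) = 0 := by
    rw [hĉdef]; exact dotc_injected hfs hdiv k₀ σ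
  have hz₀ : ‖((σ : ℂ) • ĉ)‖ = σ * c := by rw [hcdef]; exact norm_injected hσ.le ĉ
  have hinj : (⟪((σ : ℂ) • ĉ), mFourierCoeff (EuclideanSpace.complexify ∘ f) k₀⟫_ℂ).re = σ * c ^ 2 := by
    rw [hcdef, hĉdef]; exact injection_value k₀ σ
  obtain ⟨ue, hue⟩ := exists_state (![k₀] : Fin 1 → (Fin 3 → ℤ)) (![((σ : ℂ) • ĉ)] : Fin 1 → (EuclideanSpace ℂ (Fin 3)))
    (one_ne_zero_gen hk₀) (one_dotc_gen hdz)
  obtain ⟨G, hGdef⟩ : ∃ G : (UnitAddTorus (Fin 3)) → (EuclideanSpace ℝ (Fin 3)), G = Φ.grad ue := ⟨_, rfl⟩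
  obtain ⟨𝔊, h𝔊def⟩ : ∃ 𝔊 : ℝ, 𝔊 = (Real.sqrt (∑ κ' ∈ Torus.freqBall N, ‖mFourierCoeff (EuclideanSpace.complexify ∘ G) κ'‖ ^ 2)) := ⟨_, rfl⟩
  have h𝔊0 : 0 ≤ 𝔊 := by rw [h𝔊def]; exact coeffNorm_nonneg N G
  -- the Leray ball and the dissipation of the mode state
  have hSball : S ^ 2 ≤ 16 * (∫ x, ‖f x‖ ^ 2) / ν ^ 2 := by
    rw [← hFsq, le_div_iff₀ (by positivity)]
    have h4F : 0 ≤ 4 * F - ν * S := by linarith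
    have hνS : 0 ≤ ν * S := by positivity
    nlinarith [mul_nonneg hνS h4F, mul_nonneg (mul_nonneg hνS hνS) (le_refl (0:ℝ))]
  have hsum1 : ∑ m, ‖(![((σ : ℂ) • ĉ)] : Fin 1 → (EuclideanSpace ℂ (Fin 3))) m‖ = σ * c := by
    simp only [Fin.sum_univ_one, Matrix.cons_val_fin_one]; exact hz₀
  have hint1 : ∫ x, ‖(∑ mm, Torus.realTrigPoly {(![k₀] : Fin 1 → (Fin 3 → ℤ)) mm} (fun _ => (![((σ : ℂ) • ĉ)] : Fin 1 → (EuclideanSpace ℂ (Fin 3))) mm)) x‖ ^ 2 ≤ S ^ 2 := by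
    refine integral_norm_sq_modes_le.trans ?_
    rw [hsum1]
    exact pow_le_pow_left₀ (by positivity) hσcS 2
  have hball1 : ∫ x, ‖(∑ mm, Torus.realTrigPoly {(![k₀] : Fin 1 → (Fin 3 → ℤ)) mm} (fun _ => (![((σ : ℂ) • ĉ)] : Fin 1 → (EuclideanSpace ℂ (Fin 3))) mm)) x‖ ^ 2 ≤ 16 * (∫ x, ‖f x‖ ^ 2) / ν ^ 2 := hint1.trans hSball
  have hgrad1 : (Torus.eGradNormSq ((∑ mm, Torus.realTrigPoly {(![k₀] : Fin 1 → (Fin 3 → ℤ)) mm} (fun _ => (![((σ : ℂ) • ĉ)] : Fin 1 → (EuclideanSpace ℂ (Fin 3))) mm)))).toReal ≤ E := by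
    have := toReal_eGradNormSq_modes_le (k := (![k₀] : Fin 1 → (Fin 3 → ℤ))) (z := (![((σ : ℂ) • ĉ)] : Fin 1 → (EuclideanSpace ℂ (Fin 3)))) (one_freq_le_gen hk₀L)
    rw [hEdef]
    exact this.trans (mul_le_mul_of_nonneg_left hint1 (by positivity))
  have hD1 : ν * (Torus.eGradNormSq ((∑ mm, Torus.realTrigPoly {(![k₀] : Fin 1 → (Fin 3 → ℤ)) mm} (fun _ => (![((σ : ℂ) • ĉ)] : Fin 1 → (EuclideanSpace ℂ (Fin 3))) mm)))).toReal ≤ 1 := (mul_le_mul_of_nonneg_left hgrad1 hν.le).trans hd2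
  have hD1' : ν * (Torus.eGradNormSq ((∑ mm, Torus.realTrigPoly {(![k₀] : Fin 1 → (Fin 3 → ℤ)) mm} (fun _ => (![((σ : ℂ) • ĉ)] : Fin 1 → (EuclideanSpace ℂ (Fin 3))) mm)))).toReal ≤ ε₀ / 2 := (mul_le_mul_of_nonneg_left hgrad1 hν.le).trans hd1
  have hαF : 0 < α * F := mul_pos hα hF
  by_cases h𝔊z : 𝔊 = 0
  · /- Case A: the multiplier has no coefficients; the injected mode itself violates the floor. -/
    refine ⟨ue, fun hfl => ?_⟩
    have hmain := floor_at_mode hfs hν Φ hΦ hθ hdz ue hue hball1 (by rw [hinj, hσc]; linarith) hfl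
    rw [← hGdef, ← h𝔊def, h𝔊z] at hmain
    simp only [mul_zero, add_zero] at hmain
    linarith
  · /- Case B: the injected beat. -/
    have h𝔊pos : 0 < 𝔊 := lt_of_le_of_ne h𝔊0 (Ne.symm h𝔊z)
    /- Step 3: the largest resolved coefficient `q`. -/
    obtain ⟨q, hqmem, hqmax⟩ := Finset.exists_max_image (Torus.freqBall (d := Fin 3) N)
      (fun κ => ‖(mFourierCoeff (EuclideanSpace.complexify ∘ G) κ)‖) ⟨0, Torus.zero_mem_freqBall N⟩
    have hcardq : 𝔊 ^ 2 ≤ (Torus.freqBall (d := Fin 3) N).card * ‖(mFourierCoeff (EuclideanSpace.complexify ∘ G) q)‖ ^ 2 := by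
      rw [h𝔊def]; exact coeffNorm_sq_le_card_mul hqmax
    obtain ⟨g, hgdef⟩ : ∃ g : (EuclideanSpace ℂ (Fin 3)), g = (mFourierCoeff (EuclideanSpace.complexify ∘ G) q) := ⟨_, rfl⟩
    rw [← hgdef, ← hcarddef] at hcardq
    have hg0 : g ≠ 0 := by
      intro h
      rw [h, norm_zero] at hcardq
      have h2 : 0 < 𝔊 ^ 2 := by positivity
      have h3 : 𝔊 ^ 2 ≤ 0 := by simpa using hcardq
      linarith
    have hq0 : q ≠ 0 := by
      rintro rfl
      apply hg0
      rw [hgdef, hGdef]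
      exact fc_grad_zero Φ _
    have hfqN : Torus.freqNormSq q ≤ (N : ℝ) ^ 2 := Torus.mem_freqBall.1 hqmem
    have hfq1 : 1 ≤ Torus.freqNormSq q := Torus.one_le_freqNormSq_of_ne_zero hq0
    /- Step 4: the frame and the polarisation direction. -/
    have hgt : ((fun j => ((q) j : ℂ)) ⬝ᵥ (WithLp.ofLp (g))) = 0 := by rw [hgdef, hGdef]; exact dotc_fc_grad Φ _ q
    obtain ⟨r, B, hr0, hrq, hrq2, hB1, hrB, hqB, hgB⟩ := frame_selection hq0 g hgt
    obtain ⟨ζ, hζdef⟩ : ∃ ζ : ℂ, ζ = ⟪g, EuclideanSpace.complexify B⟫_ℂ := ⟨_, rfl⟩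
    rw [← hζdef] at hgB
    have hζ0 : ζ ≠ 0 := by
      intro h
      rw [h, norm_zero] at hgB
      have h2 : ‖g‖ ^ 2 ≤ 0 := by simpa using hgB
      have h3 : ‖g‖ ^ 2 = 0 := le_antisymm h2 (sq_nonneg _)
      exact hg0 (norm_eq_zero.1 (pow_eq_zero_iff two_ne_zero |>.1 h3))
    /- Step 5: the wave frequencies. -/
    obtain ⟨t, p, hpdef, hpq, hNp, hNpq, hN1, hN2, hN3, hN4, hN5, hLp, hLpq⟩ :=
      wave_frequencies_gen N hfqN hr0 hrq hrq2 hK1 hk₀K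
    rw [← hLdef] at hLp hLpq
    have hp0 : p ≠ 0 := ne_zero_of_freqNormSq_pos (sq_nonneg _) hNp
    have hpq0 : p + q ≠ 0 := ne_zero_of_freqNormSq_pos (sq_nonneg _) hNpq
    /- Step 6: the polarisations of the waves (FIXED amplitude `α`). -/
    have hzA : ‖((((α) / Real.sqrt (Torus.freqNormSq (q)) : ℝ) : ℂ) • EuclideanSpace.complexify (WithLp.toLp 2 (fun i => ((q) i : ℝ))))‖ = α := norm_polA hα.le hq0
    have hzB : ‖(((-Complex.I * conj ((ζ)) * ((‖(ζ)‖⁻¹ : ℝ) : ℂ)) * ((α) : ℂ)) • EuclideanSpace.complexify (B))‖ = α := norm_polB α hα.le hζ0 hB1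
    have hdA : ((fun j => ((p) j : ℂ)) ⬝ᵥ (WithLp.ofLp (((((α) / Real.sqrt (Torus.freqNormSq (q)) : ℝ) : ℂ) • EuclideanSpace.complexify (WithLp.toLp 2 (fun i => ((q) i : ℝ))))))) = 0 := by
      rw [dotc_polA, hpq]; simp
    have hdB : ((fun j => (((p + q)) j : ℂ)) ⬝ᵥ (WithLp.ofLp ((((-Complex.I * conj ((ζ)) * ((‖(ζ)‖⁻¹ : ℝ) : ℂ)) * ((α) : ℂ)) • EuclideanSpace.complexify (B))))) = 0 := by
      rw [dotc_polB]
      have hsum : (∑ j, ((p + q) j : ℝ) * B j) = 0 := by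
        have e : ∀ j, ((p + q) j : ℝ) * B j = (t : ℝ) * ((r j : ℝ) * B j) + (q j : ℝ) * B j := by
          intro j
          rw [hpdef]
          simp only [Pi.add_apply, Int.cast_add, Int.cast_mul, Int.cast_natCast]
          ring
        simp_rw [e, Finset.sum_add_distrib, ← Finset.mul_sum, hrB, hqB]
        ring
      rw [hsum]; simp
    obtain ⟨uw, huw⟩ := exists_state (![k₀, p, p + q] : Fin 3 → (Fin 3 → ℤ))
      (![((σ : ℂ) • ĉ), ((((α) / Real.sqrt (Torus.freqNormSq (q)) : ℝ) : ℂ) • EuclideanSpace.complexify (WithLp.toLp 2 (fun i => ((q) i : ℝ)))), (((-Complex.I * conj ((ζ)) * ((‖(ζ)‖⁻¹ : ℝ) : ℂ)) * ((α) : ℂ)) • EuclideanSpace.complexify (B))] : Fin 3 → (EuclideanSpace ℂ (Fin 3)))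
      (three_ne_zero_gen hk₀ hp0 hpq0) (three_dotc_gen hdz hdA hdB)
    -- transversality of the multiplier at `-q` makes the `(p + q, p)` interaction vanish
    have hAq : ⟪(mFourierCoeff (EuclideanSpace.complexify ∘ (Φ.grad ue)) (-q)), ((((α) / Real.sqrt (Torus.freqNormSq (q)) : ℝ) : ℂ) • EuclideanSpace.complexify (WithLp.toLp 2 (fun i => ((q) i : ℝ))))⟫_ℂ = 0 := by
      rw [inner_polA]
      have h := dotc_fc_grad Φ ue (-q)
      rw [dotc_neg_left, neg_eq_zero] at h
      rw [h, map_zero, mul_zero]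
    -- the value of the beat and the gain
    have hbeat0 : Real.pi * (conj (((fun j => ((q) j : ℂ)) ⬝ᵥ (WithLp.ofLp (((((α) / Real.sqrt (Torus.freqNormSq (q)) : ℝ) : ℂ) • EuclideanSpace.complexify (WithLp.toLp 2 (fun i => ((q) i : ℝ)))))))) *
        ⟪(mFourierCoeff (EuclideanSpace.complexify ∘ (Φ.grad ue)) q), (((-Complex.I * conj ((ζ)) * ((‖(ζ)‖⁻¹ : ℝ) : ℂ)) * ((α) : ℂ)) • EuclideanSpace.complexify (B))⟫_ℂ).im ≤
        -(Real.pi * α * α * Real.sqrt (Torus.freqNormSq q) * ‖ζ‖) := by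
      rw [← hGdef, ← hgdef, hζdef]
      exact (beat_value g hq0 α α B (hζdef ▸ hζ0)).le
    have hgain : (F + 2) * 𝔊 ≤ Real.pi * α * α * Real.sqrt (Torus.freqNormSq q) * ‖ζ‖ :=
      gain_gen (by linarith) h𝔊0 hΛ.le hΛsq hαsq hcardq hgB (norm_nonneg ζ) hfq1
    have hbeat : Real.pi * (conj (((fun j => ((q) j : ℂ)) ⬝ᵥ (WithLp.ofLp (((((α) / Real.sqrt (Torus.freqNormSq (q)) : ℝ) : ℂ) • EuclideanSpace.complexify (WithLp.toLp 2 (fun i => ((q) i : ℝ)))))))) *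
        ⟪(mFourierCoeff (EuclideanSpace.complexify ∘ (Φ.grad ue)) q), (((-Complex.I * conj ((ζ)) * ((‖(ζ)‖⁻¹ : ℝ) : ℂ)) * ((α) : ℂ)) • EuclideanSpace.complexify (B))⟫_ℂ).im ≤ -((F + 2) * 𝔊) :=
      hbeat0.trans (by linarith)
    /- Step 7: energies of the beat state and the FLOOR there. -/
    have hsum3 : ∑ m, ‖(![((σ : ℂ) • ĉ), ((((α) / Real.sqrt (Torus.freqNormSq (q)) : ℝ) : ℂ) • EuclideanSpace.complexify (WithLp.toLp 2 (fun i => ((q) i : ℝ)))), (((-Complex.I * conj ((ζ)) * ((‖(ζ)‖⁻¹ : ℝ) : ℂ)) * ((α) : ℂ)) • EuclideanSpace.complexify (B))] : Fin 3 → (EuclideanSpace ℂ (Fin 3))) m‖ = S := by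
      simp only [Fin.sum_univ_three, Matrix.cons_val_zero, Matrix.cons_val_one, Matrix.cons_val_two,
        Matrix.head_cons, Matrix.tail_cons, Fin.isValue]
      rw [hz₀, hzA, hzB, hSdef]; ring
    have hint3 : ∫ x, ‖(∑ mm, Torus.realTrigPoly {(![k₀, p, p + q] : Fin 3 → (Fin 3 → ℤ)) mm} (fun _ => (![((σ : ℂ) • ĉ), ((((α) / Real.sqrt (Torus.freqNormSq (q)) : ℝ) : ℂ) • EuclideanSpace.complexify (WithLp.toLp 2 (fun i => ((q) i : ℝ)))), (((-Complex.I * conj ((ζ)) * ((‖(ζ)‖⁻¹ : ℝ) : ℂ)) * ((α) : ℂ)) • EuclideanSpace.complexify (B))] : Fin 3 → (EuclideanSpace ℂ (Fin 3))) mm)) x‖ ^ 2 ≤ S ^ 2 := by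
      refine integral_norm_sq_modes_le.trans ?_
      rw [hsum3]
    have hball3 : ∫ x, ‖(∑ mm, Torus.realTrigPoly {(![k₀, p, p + q] : Fin 3 → (Fin 3 → ℤ)) mm} (fun _ => (![((σ : ℂ) • ĉ), ((((α) / Real.sqrt (Torus.freqNormSq (q)) : ℝ) : ℂ) • EuclideanSpace.complexify (WithLp.toLp 2 (fun i => ((q) i : ℝ)))), (((-Complex.I * conj ((ζ)) * ((‖(ζ)‖⁻¹ : ℝ) : ℂ)) * ((α) : ℂ)) • EuclideanSpace.complexify (B))] : Fin 3 → (EuclideanSpace ℂ (Fin 3))) mm)) x‖ ^ 2 ≤ 16 * (∫ x, ‖f x‖ ^ 2) / ν ^ 2 := hint3.trans hSball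
    have hgrad3 : (Torus.eGradNormSq ((∑ mm, Torus.realTrigPoly {(![k₀, p, p + q] : Fin 3 → (Fin 3 → ℤ)) mm} (fun _ => (![((σ : ℂ) • ĉ), ((((α) / Real.sqrt (Torus.freqNormSq (q)) : ℝ) : ℂ) • EuclideanSpace.complexify (WithLp.toLp 2 (fun i => ((q) i : ℝ)))), (((-Complex.I * conj ((ζ)) * ((‖(ζ)‖⁻¹ : ℝ) : ℂ)) * ((α) : ℂ)) • EuclideanSpace.complexify (B))] : Fin 3 → (EuclideanSpace ℂ (Fin 3))) mm)))).toReal ≤ E := by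
      have := toReal_eGradNormSq_modes_le (k := (![k₀, p, p + q] : Fin 3 → (Fin 3 → ℤ)))
        (z := (![((σ : ℂ) • ĉ), ((((α) / Real.sqrt (Torus.freqNormSq (q)) : ℝ) : ℂ) • EuclideanSpace.complexify (WithLp.toLp 2 (fun i => ((q) i : ℝ)))), (((-Complex.I * conj ((ζ)) * ((‖(ζ)‖⁻¹ : ℝ) : ℂ)) * ((α) : ℂ)) • EuclideanSpace.complexify (B))] : Fin 3 → (EuclideanSpace ℂ (Fin 3)))) (three_freq_le_gen hk₀L hLp hLpq)
      rw [hEdef]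
      exact this.trans (mul_le_mul_of_nonneg_left hint3 (by positivity))
    have hD3 : ν * (Torus.eGradNormSq ((∑ mm, Torus.realTrigPoly {(![k₀, p, p + q] : Fin 3 → (Fin 3 → ℤ)) mm} (fun _ => (![((σ : ℂ) • ĉ), ((((α) / Real.sqrt (Torus.freqNormSq (q)) : ℝ) : ℂ) • EuclideanSpace.complexify (WithLp.toLp 2 (fun i => ((q) i : ℝ)))), (((-Complex.I * conj ((ζ)) * ((‖(ζ)‖⁻¹ : ℝ) : ℂ)) * ((α) : ℂ)) • EuclideanSpace.complexify (B))] : Fin 3 → (EuclideanSpace ℂ (Fin 3))) mm)))).toReal ≤ 1 := (mul_le_mul_of_nonneg_left hgrad3 hν.le).trans hd2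
    have hD3' : ν * (Torus.eGradNormSq ((∑ mm, Torus.realTrigPoly {(![k₀, p, p + q] : Fin 3 → (Fin 3 → ℤ)) mm} (fun _ => (![((σ : ℂ) • ĉ), ((((α) / Real.sqrt (Torus.freqNormSq (q)) : ℝ) : ℂ) • EuclideanSpace.complexify (WithLp.toLp 2 (fun i => ((q) i : ℝ)))), (((-Complex.I * conj ((ζ)) * ((‖(ζ)‖⁻¹ : ℝ) : ℂ)) * ((α) : ℂ)) • EuclideanSpace.complexify (B))] : Fin 3 → (EuclideanSpace ℂ (Fin 3))) mm)))).toReal ≤ ε₀ / 2 := (mul_le_mul_of_nonneg_left hgrad3 hν.le).trans hd1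
    refine ⟨uw, fun hfl => ?_⟩
    have hmain := floor_at_injected_beat hfs hν Φ hΦ hθ hdz hdA hdB ue hue uw huw hNp hNpq hN1 hN2 hN3 hN4 hN5
      hAq hbeat hball3 (by rw [hinj, hzA, hzB, ← hFdef, hσc]; linarith) hfl
    rw [← hGdef, ← h𝔊def, ← hFdef, hz₀] at hmain
    -- the Laplacian term is at most `𝔊`
    have hlap1 : ν * (σ * c * (4 * Real.pi ^ 2 * Torus.freqNormSq k₀)) ≤ 1 := by
      have hmono : σ * c * (4 * Real.pi ^ 2 * Torus.freqNormSq k₀) ≤ σ * c * (4 * Real.pi ^ 2 * K) :=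
        mul_le_mul_of_nonneg_left (mul_le_mul_of_nonneg_left hk₀K (by positivity)) (by positivity)
      exact (mul_le_mul_of_nonneg_left hmono hν.le).trans hd3
    have hlap : ν * (σ * c * (4 * Real.pi ^ 2 * Torus.freqNormSq k₀) * 𝔊) ≤ 𝔊 := by
      calc ν * (σ * c * (4 * Real.pi ^ 2 * Torus.freqNormSq k₀) * 𝔊)
          = (ν * (σ * c * (4 * Real.pi ^ 2 * Torus.freqNormSq k₀))) * 𝔊 := by ring
        _ ≤ 1 * 𝔊 := mul_le_mul_of_nonneg_right hlap1 h𝔊0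
        _ = 𝔊 := one_mul _
    linarith

/-- **No floor certificate of bounded resolution exists, for any force** (refutation of the natural
strengthening `FloorCertificateFixedResolution`; witness: the injected beat). MORAL: the resolution of the
multiplier of any witness of `FloorCertificate` must grow without bound as `ν → 0`; an unbounded weight
`θ₁(ν)` and a `ν`-dependent profile `φ_ν` cannot substitute for it. -/
theorem not_floorCertificateFixedResolution : ¬ FloorCertificateFixedResolution := by
  rintro ⟨f, hfs, hdiv, hmean, ε₀, ν₀, N, hε₀, hν₀, hcert⟩
  obtain ⟨ν₁, hν₁, hfail⟩ := floor_fails_at_fixed_resolution hfs hdiv hmean hε₀ N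
  have hν : 0 < min ν₁ (ν₀ / 2) := lt_min hν₁ (half_pos hν₀)
  obtain ⟨Φ, θ, hΦ, hθ, hall⟩ := hcert (min ν₁ (ν₀ / 2)) hν ((min_le_right _ _).trans_lt (half_lt_self hν₀))
  obtain ⟨u, hu⟩ := hfail (min ν₁ (ν₀ / 2)) hν (min_le_left _ _) Φ θ hΦ hθ
  exact hu (hall u)

/-- **What a witness of the crux must look like (resolution).** For the force of any floor family, every
degree `N` and every `ε₀ > 0`, below a threshold `ν₁(f, ε₀, N) > 0` EVERY valid certificate `(Φ₁, θ₁)`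
(`θ₁ ≤ 0`, floor at level `ε₀` on the whole finite-enstrophy Leray ball) uses a test field which is NOT a
trigonometric polynomial of degree `≤ N`. -/
theorem floor_witness_exceeds_resolution {f : (UnitAddTorus (Fin 3) → EuclideanSpace ℝ (Fin 3))} (hfs : Torus.IsSmooth f)
    (hdiv : Torus.IsDivFree f) (hmean : Torus.HasZeroMean f) {ε₀ : ℝ} (hε₀ : 0 < ε₀) (N : ℕ) :
    ∃ ν₁ : ℝ, 0 < ν₁ ∧ ∀ ν : ℝ, 0 < ν → ν ≤ ν₁ →
      ∀ (Φ : Torus.CylindricalTest (Fin 3)) (θ : ℝ), θ ≤ 0 →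
        (∀ u : (Torus.energySpace (Fin 3)), FloorIneq ν f Φ θ ε₀ u) →
          ∃ i, Torus.fourierTruncate N (Φ.g i) ≠ Φ.g i := by
  obtain ⟨ν₁, hν₁, hfail⟩ := floor_fails_at_fixed_resolution hfs hdiv hmean hε₀ N
  refine ⟨ν₁, hν₁, fun ν hν hle Φ θ hθ hall => ?_⟩
  by_contra hcon
  push Not at hcon
  obtain ⟨u, hu⟩ := hfail ν hν hle Φ θ hcon hθ
  exact hu (hall u)

/-! ## §G What a witness of the crux must deliver (packaged for the provers) -/

/-- **Witness requirements.** If `FloorCertificate` holds with witness force `f` and budgets `ε₀, ν₀`, then: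
(o) `f ≠ 0`; (i) for every `ν < ν₀` EVERY steady weak solution `u ∈ V` of `NS_ν(f)` has `ν‖∇u‖² ≥ ε₀` and
(ii) EVERY stationary statistical solution of `NS_ν(f)` has mean dissipation `≥ ε₀` (weak duality); (iii) for every
degree `N` there is `ν₁ > 0` below which EVERY valid certificate `(Φ₁, θ₁)` for `(f, ε₀, ν)` uses a test field of
degree `> N` — the resolution of the multipliers is unbounded as `ν → 0`, whatever the weights (injected beat). -/
theorem witness_requirements (h : FloorCertificate) :
    ∃ f : (UnitAddTorus (Fin 3) → EuclideanSpace ℝ (Fin 3)), Torus.IsSmooth f ∧ Torus.IsDivFree f ∧ Torus.HasZeroMean f ∧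
      0 < (∫ x, ‖f x‖ ^ 2) ∧ ∃ ε₀ ν₀ : ℝ, 0 < ε₀ ∧ 0 < ν₀ ∧
      (∀ ν : ℝ, 0 < ν → ν < ν₀ → FloorFamily f ε₀ ν) ∧
      (∀ ν : ℝ, 0 < ν → ν < ν₀ → ∀ u : (Torus.energySpace (Fin 3)),
        (u : (Lp (EuclideanSpace ℝ (Fin 3)) 2 (volume : Measure (UnitAddTorus (Fin 3))))) ∈ Torus.energySpaceV (Fin 3) →
          Torus.IsSteadyWeakSolution ν f u →
            ε₀ ≤ ν * (Torus.eGradNormSq ((u : (Lp (EuclideanSpace ℝ (Fin 3)) 2 (volume : Measure (UnitAddTorus (Fin 3))))) : (UnitAddTorus (Fin 3) → EuclideanSpace ℝ (Fin 3)))).toReal) ∧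
      (∀ ν : ℝ, 0 < ν → ν < ν₀ → ∀ μ : Measure (Torus.energySpace (Fin 3)),
        Torus.IsStationaryStatisticalSolution ν f μ → ε₀ ≤ Torus.ensembleDissipation ν μ) ∧
      (∀ N : ℕ, ∃ ν₁ : ℝ, 0 < ν₁ ∧ ∀ ν : ℝ, 0 < ν → ν ≤ ν₁ →
        ∀ (Φ : Torus.CylindricalTest (Fin 3)) (θ : ℝ), θ ≤ 0 →
          (∀ u : (Torus.energySpace (Fin 3)), FloorIneq ν f Φ θ ε₀ u) → ∃ i, Torus.fourierTruncate N (Φ.g i) ≠ Φ.g i) := by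
  obtain ⟨f, hfs, hdiv, hmean, ε₀, ν₀, hε₀, hν₀, hcert⟩ := h
  have hf2 : MemLp f 2 volume := hfs.memLp 2
  refine ⟨f, hfs, hdiv, hmean, ?_, ε₀, ν₀, hε₀, hν₀, hcert, ?_, ?_, ?_⟩
  · exact floorFamily_force_ne_zero hfs hε₀ (half_pos hν₀) (hcert (ν₀ / 2) (half_pos hν₀) (by linarith))
  · exact fun ν hν hνν₀ u hV hu => floorFamily_le_dissipation_of_steady hν hf2 (hcert ν hν hνν₀) hV hu
  · exact fun ν hν hνν₀ μ hμ => floorFamily_le_ensembleDissipation hν hf2 (hcert ν hν hνν₀) hμ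
  · exact fun N => floor_witness_exceeds_resolution hfs hdiv hmean hε₀ N

end Summit.AnomalousDissipation.AnomalousDissipation.Theorems.FloorCertificate.Negative
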